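import Summits.AtomisticToContinuum.Crystallization.Theorems.FrustratedLawDichotomyStrainedPatchHomCurvNearNodup
import Summits.AtomisticToContinuum.Crystallization.Theorems.FrustratedLawDichotomyStrainedPatchHomTermCalculus

/-!
# The B-family box sum equals the near-label sum (far labels carry `W₄₅ = 0`), and the centred ++ naive split covers the near labels

decomp-a2c hand-1 g27 (crux `AperiodicFrustratedLawGap`, stmt-AtomisticToContinuum-27623; `(H) HomFloor (1/625)`, hcp half; lever (C)).  The `hver`
energy disjunct of `…HomForceHcp.entryLeafOKHX_sound` sums `W₄₅‖latPt U hexFrame b + U(hcpShift + ξ)‖` over the FULL index box `[−7,7]³`, whereas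
the curvature / slope / value leaves run over the in-kernel list `nearLabels c w r2n r2d` (or its centred ++ naive split).  With `r2n/r2d ≥ (9/2)²`
the two sums agree: a label rejected by the near filter has `‖·‖² ≥ r2n/r2d` on the whole box (`…HomCurvNear.far_of_not_near`) and
`W₄₅ = 0` from `9/2` on (`…HomTermCalculus.effPot45_eq_far`).

★ `boxSum_eq_nearSum`, `toFinset_filter_append` (the split `l.filter p ++ l.filter ¬p` has the same finset as `l`).
NO definitions; 0 sorry; standard axioms; no instances / notation / `#eval`.  `--supports stmt-AtomisticToContinuum-27623`.
-/

noncomputable section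

namespace Summit.AtomisticToContinuum.Crystallization.Theorems.FrustratedLawDichotomyStrainedPatchHomCurvLeaf

open scoped BigOperators
open Literature.Analysis.ValidatedNumerics.Numerics
open Summit.AtomisticToContinuum.Crystallization.Theorems.ChargedEnergyGapNegative (E3)
open Summit.AtomisticToContinuum.Crystallization.Theorems.FrustratedLawDichotomySchurCut (effPot w₄₅ ω₄)
open Summit.AtomisticToContinuum.Crystallization.Theorems.FrustratedLawDichotomyStrainedPatchHomSplit (latPt hexFrame hcpShift)
open Summit.AtomisticToContinuum.Crystallization.Theorems.FrustratedLawDichotomyStrainedPatchHomTermCalculus (effPot45_eq_far)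

/-- ★ **Box sum = near-label sum** for the `B`-family energy: with `r2n/r2d ≥ 81/4`, every `U, ξ` in the box `(c, w)`:
`Σ_{b ∈ [−7,7]³} W₄₅‖latPt U hexFrame b + U(hcpShift + ξ)‖ = Σ_{b ∈ (nearLabels c w r2n r2d).toFinset} W₄₅‖…‖`. [folklore] -/
theorem boxSum_eq_nearSum {c w : (Fin 3 × Fin 3) ⊕ Fin 3 → ℤ} {r2n : ℤ} {r2d : ℕ} (hd : 0 < r2d) (hr : (81 / 4 : ℝ) ≤ (r2n : ℝ) / r2d)
    (U : E3 →L[ℝ] E3)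
    (hbox : ∀ ab : Fin 3 × Fin 3, |(U (EuclideanSpace.single ab.2 (1 : ℝ))) ab.1 - (c (Sum.inl ab) : ℝ) / SC| ≤ (w (Sum.inl ab) : ℝ) / SC)
    (ξ : E3) (hξ : ∀ i : Fin 3, |ξ i - (c (Sum.inr i) : ℝ) / SC| ≤ (w (Sum.inr i) : ℝ) / SC) :
    ∑ b ∈ (Fintype.piFinset fun _ : Fin 3 => Finset.Icc (-7 : ℤ) 7), effPot w₄₅ ω₄ (3 / 400) ‖latPt U hexFrame b + U (hcpShift + ξ)‖ =
      ∑ b ∈ (nearLabels c w r2n r2d).toFinset, effPot w₄₅ ω₄ (3 / 400) ‖latPt U hexFrame b + U (hcpShift + ξ)‖ := by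
  classical
  rw [← boxLabels7_toFinset]
  symm
  refine Finset.sum_subset (fun b hb => List.mem_toFinset.2 (mem_boxLabels7_of_mem_nearLabels (List.mem_toFinset.1 hb))) ?_
  intro b hb hnot
  have hb7 : b ∈ boxLabels7 := List.mem_toFinset.1 hb
  have hnot' : b ∉ nearLabels c w r2n r2d := fun h => hnot (List.mem_toFinset.2 h)
  have hfar := far_of_not_near hd hb7 hnot' U ξ hbox hξ
  have hsq : (9 / 2 : ℝ) ^ 2 ≤ ‖latPt U hexFrame b + U (hcpShift + ξ)‖ ^ 2 := by nlinarith
  have h92 : (9 / 2 : ℝ) ≤ ‖latPt U hexFrame b + U (hcpShift + ξ)‖ := by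
    have := abs_le_of_sq_le_sq' hsq (norm_nonneg _)
    linarith [this.2, abs_of_pos (show (0 : ℝ) < 9 / 2 by norm_num)]
  exact effPot45_eq_far h92

/-- ★ The split `l.filter p ++ l.filter (¬p)` has the same finset as `l` (centred ++ naive = near labels). [folklore] -/
theorem toFinset_filter_append {α : Type*} [DecidableEq α] (l : List α) (p : α → Bool) :
    (l.filter p ++ l.filter fun a => !p a).toFinset = l.toFinset := by
  ext a
  simp only [List.mem_toFinset, List.mem_append, List.mem_filter]
  constructor
  · rintro (⟨h, _⟩ | ⟨h, _⟩) <;> exact h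
  · intro h
    cases p a
    · exact Or.inr ⟨h, by simp⟩
    · exact Or.inl ⟨h, rfl⟩

end Summit.AtomisticToContinuum.Crystallization.Theorems.FrustratedLawDichotomyStrainedPatchHomCurvLeaf

end
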